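import Summits.HodgeConjecture.HodgeCM.PerL34.PrintedSmoothEndState_1

/-! PORT of `HodgeCM/PerL34/PrintedSmoothEndState.lean` (HodgeCMPerL run 82) — part 2: continuation of `Summits.HodgeConjecture.HodgeCM.PerL34.PrintedSmoothEndState_1` (split at a top-level declaration boundary by port_pkg.py; scope re-opened below; declarations unchanged). -/

-- port_pkg: scope re-opened for this part (file-level context, then the namespace/section stack open at the cut)
set_option autoImplicit false
noncomputable section
open scoped Topology
open Filter MeasureTheory
namespace HodgeCM
namespace Universe
namespace AdelicThetaCore
open HodgeCM.PerL34
variable {U : Universe} {hP : PrintFact_unitaryCompact} (C₀ : U.AdelicThetaCore hP) (h : Bool)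
  (d12 d34 : ∀ {L : CMField}, SeesawCtx L → SideData L)
/-- **`Open_occ` of prl1-g5's END-STATE model with LINEAR Weil theta models from the 𝒯-free linear cores** (by `rfl`
on `Open_occ_of_linSmoothCores`). -/
theorem Open_occ_thetaModel_of_linSmoothCores
    (lin : ∀ {L : CMField} {ι₁ : L →+* ℂ} (V : HermSpace3 L ι₁) (c : SeesawCtx L), ((C₀.toCore h).wm V c).LinearStr)
    (A12 : ∀ {L : CMField} {ι₁ : L →+* ℂ} (V : HermSpace3 L ι₁) (c : SeesawCtx L),
      (C₀.thetaModel h d12 d34).GoodCtx ι₁ c →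
        Nonempty ((C₀.toCore h).LinSmoothCore12 ((C₀.toCore h).side12 d12) ((C₀.toCore h).side34 d34)
          ((C₀.toCore h).analyticKM ((C₀.toCore h).side12 d12) ((C₀.toCore h).side34 d34)).toAnalytic V c
          (ℓ := lin V c)))
    (A34 : ∀ {L : CMField} {ι₁ : L →+* ℂ} (V : HermSpace3 L ι₁) (c : SeesawCtx L),
      (C₀.thetaModel h d12 d34).GoodCtx ι₁ c →
        Nonempty ((C₀.toCore h).LinSmoothCore34 ((C₀.toCore h).side12 d12) ((C₀.toCore h).side34 d34)
          ((C₀.toCore h).analyticKM ((C₀.toCore h).side12 d12) ((C₀.toCore h).side34 d34)).toAnalytic V c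
          (ℓ := lin V c))) :
    (C₀.thetaModel h d12 d34).Open_occ :=
  (C₀.toCore h).Open_occ_of_linSmoothCores _ _ _ lin A12 A34

end AdelicThetaCore

end Universe

/-! ## §4  The binder-minimal END STATE with `occ` from 𝒯-free linear cores -/

namespace Assembly

open HodgeCM.PerL34
open HodgeCM.Prior.Perl34File HodgeCM.Prior.Perl34File.Perl34
open HodgeCM.Universe (AdelicThetaCore AdelicThetaCore₀ AdelicTorusCore SideData ThetaModel)

variable (U : Universe)

/-- **PerL, binder-minimal END STATE with LINEAR Weil theta models, `occ` from nine 𝒯-FREE fields per good context and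
pair** (`perL_ofSignRecipe₀` with `Open_occ := Open_occ_thetaModel_of_linSmoothCores`). -/
theorem perL_ofSignRecipe₀_linSmoothCores (M : U.ModelAxioms) (h : Bool) (C : U.AdelicThetaCore₀)
    (d12 d34 : ∀ {L : CMField}, SeesawCtx L → SideData L)
    (lin : ∀ {L : CMField} {ι₁ : L →+* ℂ} (V : HermSpace3 L ι₁) (c : SeesawCtx L), ((C.toCore h).wm V c).LinearStr)
    (embCover : (C.thetaModel h d12 d34).Fact_embCover) (innerEmb : (C.thetaModel h d12 d34).Fact_innerEmb)
    (thetaSub : (C.thetaModel h d12 d34).Open_thetaSub) (thetaWedge : (C.thetaModel h d12 d34).Open_thetaWedge)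
    (thetaGen12 : (C.thetaModel h d12 d34).Open_thetaGen12)
    (thetaReal34 : (C.thetaModel h d12 d34).Open_thetaReal34) (chars : (C.thetaModel h d12 d34).Open_chars)
    (A12 : ∀ {L : CMField} {ι₁ : L →+* ℂ} (V : HermSpace3 L ι₁) (c : SeesawCtx L),
      (C.thetaModel h d12 d34).GoodCtx ι₁ c →
        Nonempty ((C.toCore h).LinSmoothCore12 ((C.toCore h).side12 d12) ((C.toCore h).side34 d34)
          ((C.toCore h).analyticKM ((C.toCore h).side12 d12) ((C.toCore h).side34 d34)).toAnalytic V c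
          (ℓ := lin V c)))
    (A34 : ∀ {L : CMField} {ι₁ : L →+* ℂ} (V : HermSpace3 L ι₁) (c : SeesawCtx L),
      (C.thetaModel h d12 d34).GoodCtx ι₁ c →
        Nonempty ((C.toCore h).LinSmoothCore34 ((C.toCore h).side12 d12) ((C.toCore h).side34 d34)
          ((C.toCore h).analyticKM ((C.toCore h).side12 d12) ((C.toCore h).side34 d34)).toAnalytic V c
          (ℓ := lin V c)))
    (hHR : U.Fact_hodgeRiemann20) : U.PerL :=
  perL_ofSignRecipe₀ U M h C d12 d34
    ⟨embCover, innerEmb, thetaSub, thetaWedge, thetaGen12, thetaReal34, chars,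
      C.Open_occ_thetaModel_of_linSmoothCores h d12 d34 lin A12 A34⟩ hHR

/-- **Both realisation inputs of part (a)**, same hypotheses. -/
theorem realisationExists_ofSignRecipe₀_linSmoothCores (M : U.ModelAxioms) (h : Bool) (C : U.AdelicThetaCore₀)
    (d12 d34 : ∀ {L : CMField}, SeesawCtx L → SideData L)
    (lin : ∀ {L : CMField} {ι₁ : L →+* ℂ} (V : HermSpace3 L ι₁) (c : SeesawCtx L), ((C.toCore h).wm V c).LinearStr)
    (embCover : (C.thetaModel h d12 d34).Fact_embCover) (innerEmb : (C.thetaModel h d12 d34).Fact_innerEmb)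
    (thetaSub : (C.thetaModel h d12 d34).Open_thetaSub) (thetaWedge : (C.thetaModel h d12 d34).Open_thetaWedge)
    (thetaGen12 : (C.thetaModel h d12 d34).Open_thetaGen12)
    (thetaReal34 : (C.thetaModel h d12 d34).Open_thetaReal34) (chars : (C.thetaModel h d12 d34).Open_chars)
    (A12 : ∀ {L : CMField} {ι₁ : L →+* ℂ} (V : HermSpace3 L ι₁) (c : SeesawCtx L),
      (C.thetaModel h d12 d34).GoodCtx ι₁ c →
        Nonempty ((C.toCore h).LinSmoothCore12 ((C.toCore h).side12 d12) ((C.toCore h).side34 d34)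
          ((C.toCore h).analyticKM ((C.toCore h).side12 d12) ((C.toCore h).side34 d34)).toAnalytic V c
          (ℓ := lin V c)))
    (A34 : ∀ {L : CMField} {ι₁ : L →+* ℂ} (V : HermSpace3 L ι₁) (c : SeesawCtx L),
      (C.thetaModel h d12 d34).GoodCtx ι₁ c →
        Nonempty ((C.toCore h).LinSmoothCore34 ((C.toCore h).side12 d12) ((C.toCore h).side34 d34)
          ((C.toCore h).analyticKM ((C.toCore h).side12 d12) ((C.toCore h).side34 d34)).toAnalytic V c
          (ℓ := lin V c)))
    (hHR : U.Fact_hodgeRiemann20) : U.RealisationExistsPerL ∧ U.RealisationExistsFace :=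
  realisationExists_ofSignRecipe₀ U M h C d12 d34
    ⟨embCover, innerEmb, thetaSub, thetaWedge, thetaGen12, thetaReal34, chars,
      C.Open_occ_thetaModel_of_linSmoothCores h d12 d34 lin A12 A34⟩ hHR

/-- **COR-CM, binder-minimal END STATE with LINEAR Weil theta models, `occ` from 𝒯-free linear cores.** -/
theorem COR_CM_endState_ofSignRecipe₀_linSmoothCores (M : U.ModelAxioms) (h29 : U.Fact_weightSpan)
    (h30 : U.Fact_weightHodge) (hE : U.Qw8ExtProd) (hD : U.Qw8DualPushPull) (hMi : U.Qw8Milne) (h : Bool)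
    (C : U.AdelicThetaCore₀) (d12 d34 : ∀ {L : CMField}, SeesawCtx L → SideData L)
    (lin : ∀ {L : CMField} {ι₁ : L →+* ℂ} (V : HermSpace3 L ι₁) (c : SeesawCtx L), ((C.toCore h).wm V c).LinearStr)
    (embCover : (C.thetaModel h d12 d34).Fact_embCover) (innerEmb : (C.thetaModel h d12 d34).Fact_innerEmb)
    (thetaSub : (C.thetaModel h d12 d34).Open_thetaSub) (thetaWedge : (C.thetaModel h d12 d34).Open_thetaWedge)
    (thetaGen12 : (C.thetaModel h d12 d34).Open_thetaGen12)
    (thetaReal34 : (C.thetaModel h d12 d34).Open_thetaReal34) (chars : (C.thetaModel h d12 d34).Open_chars)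
    (A12 : ∀ {L : CMField} {ι₁ : L →+* ℂ} (V : HermSpace3 L ι₁) (c : SeesawCtx L),
      (C.thetaModel h d12 d34).GoodCtx ι₁ c →
        Nonempty ((C.toCore h).LinSmoothCore12 ((C.toCore h).side12 d12) ((C.toCore h).side34 d34)
          ((C.toCore h).analyticKM ((C.toCore h).side12 d12) ((C.toCore h).side34 d34)).toAnalytic V c
          (ℓ := lin V c)))
    (A34 : ∀ {L : CMField} {ι₁ : L →+* ℂ} (V : HermSpace3 L ι₁) (c : SeesawCtx L),
      (C.thetaModel h d12 d34).GoodCtx ι₁ c →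
        Nonempty ((C.toCore h).LinSmoothCore34 ((C.toCore h).side12 d12) ((C.toCore h).side34 d34)
          ((C.toCore h).analyticKM ((C.toCore h).side12 d12) ((C.toCore h).side34 d34)).toAnalytic V c
          (ℓ := lin V c)))
    (hHR : U.Fact_hodgeRiemann20) : U.HC_CM :=
  COR_CM_endState_ofSignRecipe₀ U M h29 h30 hE hD hMi h C d12 d34
    ⟨embCover, innerEmb, thetaSub, thetaWedge, thetaGen12, thetaReal34, chars,
      C.Open_occ_thetaModel_of_linSmoothCores h d12 d34 lin A12 A34⟩ hHR

end Assembly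

end HodgeCM

end
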